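import Mathlib
import Summits.BirchSwinnertonDyer.BirchSwinnertonDyer.Theorems.ResidualThetaTransportAtTwoSignedMuSeedAtTwoPlusNonsquareDescentEngine
import HarnessLib

/-!
# Non-square descent — THE `μ`-CRITERION `μ(Q') = 0 ⟺ ū_∞ ∉ torsion ⟺ ∃ m GNS(m)` IN MODULE FORM (stub S3 (c) of the line card
# `nonsquare-descent`) for the seed crux `SignedMuSeedAtTwoPlus` stmt-BirchSwinnertonDyer-21438 (parent Kμ⁺ `SignedMuVanishingAtTwoPlus`
# stmt-BirchSwinnertonDyer-20689, route ResidualThetaTransportAtTwo)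

Cell `bsd-wall`, width seat `bsd-wall-rtt-p4-w2` g17 (`--supports`, closes nothing).  THEOREMS ONLY; BSD is not proved by this and
nothing arithmetic is asserted: module algebra over a commutative ring / domain.

Stub S3 of `Cruxes/SignedMuSeedAtTwoPlus/Lines/nonsquare-descent.md`, input (c): «`Ē` is `ℤ₂`-torsion-free, so
`V_∞ = Ē^χ/2 ≅ 𝔽₄⟦T⟧ ⊕ finite` and `μ(Q') = 0 ⟺ Q'/2 = V_∞/Ω'ū_∞` finite `⟺ ū_∞ ≠ 0`» (in the free part), together with the converse
«`¬GNS(∀m) ⟹ u_∞ ∈ 2Ē^χ ⟹ #B'_n ≥ 4^{2ⁿ} ⟹ μ ≥ …`».  Dictionary: `R = Λ'`, `E = Ē^χ`, `u = u_∞`, `ϖ = 2`, `Q' = E ⧸ R∙u`,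
`S = Λ'/2 = 𝔽₄⟦T⟧` (a domain), `V = V_∞ = E/2E` of `S`-rank one (`rank_{Λ'} Ē^χ = 1`), `v = ū_∞`; level `n`: `E = 𝓔_n^χ`, `u = u_n`.

* §1 **rank one: the quotient by a line is torsion iff the generator is non-torsion.**  Over a domain `S`, in a module `V` in which any two
  elements are linearly dependent (`rank ≤ 1`): `exists_smul_mem_span_of_rank_le_one`, `isTorsion_quotient_span_of_nonTorsion`
  (`v` non-torsion ⇒ `V ⧸ S∙v` is torsion — «`Q'/2` finite», i.e. `μ(Q') = 0`, once torsion f.g. `𝔽₄⟦T⟧`-modules are finite), and the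
  converse `exists_nonTorsion_quotient_of_torsion` (`v` torsion and some non-torsion `w ∈ V` ⇒ `V ⧸ S∙v` has a non-torsion element —
  «`μ(Q') ≥ 1`»); `isTorsion_quotient_span_iff`.
* §2 **`Q'/ϖ` versus `V/⟨v̄⟩` bookkeeping**: `nonempty_quotient_quotient_linearEquiv` (`(E ⧸ R∙u) ⧸ ϖ ≃ E ⧸ (R∙u ⊔ ϖE)`),
  `nonempty_modSMul_quotient_linearEquiv` (`(E ⧸ ϖE) ⧸ ⟨ū⟩ ≃ E ⧸ (R∙u ⊔ ϖE)`), `span_sup_smul_top_eq_of_mem` (`u ∈ ϖE ⇒ R∙u ⊔ ϖE = ϖE`: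
  «`u_∞ ∈ 2Ē ⟹ Q'/2 = Ē/2`»), `natCard_quotient_smul_top_dvd_of_mem` (**finite level: `u_n ∈ 2𝓔_n^χ ⇒ #(𝓔_n^χ/2) ∣ #B'_n`**, the
  card's `#B'_n ≥ 4^{2ⁿ}`).
* §3 **from one level to the limit**: `smul_ne_zero_of_proj_ne_zero` — with compatible projections `π n : V_∞ → V n` carrying `ū_∞` to the
  coherent family `ū_n` of the squares-dichotomy engine (`Theorems/…NonsquareDescentEngine.lean`), ONE `ū_m ≠ 0` (GNS(m)) makes `ū_∞`
  NON-TORSION over `k⟦X⟧` (`exists_smul_ne_zero_of_ne_zero_powerSeries`); `eq_zero_of_forall_proj_eq_zero` — conversely `ū_m = 0` for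
  all `m` and jointly injective projections give `ū_∞ = 0`.  With §1 this is the card's «`μ(Q') = 0 ⟺ ∃ m GNS(m)`» at the module level.
* §4 (appended) **the card's structure «`V_∞ ≅ 𝔽₄⟦T⟧ ⊕ finite`» feeds §1**: `rank_le_one_of_linearEquiv_prod` — `V ≃ S × F` with `F` torsion
  ⇒ any two elements of `V` are dependent (the `rank ≤ 1` hypothesis `hrank`); `exists_nonTorsion_of_linearEquiv_prod` — `e⁻¹(1, 0)` is a
  non-torsion element (the hypothesis `hw`).

[folklore]
-/

set_option autoImplicit false
-- the Theorems namespace of this sub repeats the summit name by design (D-0017 nested layout)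
set_option linter.dupNamespace false

open scoped Pointwise

namespace Summit.BirchSwinnertonDyer.BirchSwinnertonDyer.Theorems.SignedMuAtTwo.NonsquareDescent

/-! ## §1 Rank one: `V ⧸ S∙v` is torsion iff `v` is non-torsion -/

section RankOne

variable {S : Type*} [CommRing S] {V : Type*} [AddCommGroup V] [Module S V]

/-- In a module of rank `≤ 1` (any two elements linearly dependent), every element has a non-zero multiple in the line spanned by a
NON-TORSION element `v`. [folklore] -/
theorem exists_smul_mem_span_of_rank_le_one
    (hrank : ∀ v w : V, ∃ a b : S, (a ≠ 0 ∨ b ≠ 0) ∧ a • v + b • w = 0)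
    {v : V} (hv : ∀ a : S, a ≠ 0 → a • v ≠ 0) (w : V) :
    ∃ b : S, b ≠ 0 ∧ b • w ∈ Submodule.span S {v} := by
  obtain ⟨a, b, hab, h⟩ := hrank v w
  have hb : b ≠ 0 := by
    rintro rfl
    rw [zero_smul, add_zero] at h
    rcases hab with ha | hb
    · exact hv a ha h
    · exact hb rfl
  refine ⟨b, hb, Submodule.mem_span_singleton.mpr ⟨-a, ?_⟩⟩
  rw [neg_smul, neg_eq_iff_add_eq_zero, h]

/-- **`v` non-torsion ⇒ `V ⧸ S∙v` torsion** (rank `≤ 1`): every class is killed by a non-zero scalar.  («`ū_∞` free ⇒ `Q'/2 = V_∞/⟨ū_∞⟩`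
torsion, i.e. finite for f.g. `𝔽₄⟦T⟧`-modules: `μ(Q') = 0`».) [folklore] -/
theorem isTorsion_quotient_span_of_nonTorsion
    (hrank : ∀ v w : V, ∃ a b : S, (a ≠ 0 ∨ b ≠ 0) ∧ a • v + b • w = 0)
    {v : V} (hv : ∀ a : S, a ≠ 0 → a • v ≠ 0) (q : V ⧸ Submodule.span S {v}) :
    ∃ b : S, b ≠ 0 ∧ b • q = 0 := by
  obtain ⟨w, rfl⟩ := Submodule.mkQ_surjective (Submodule.span S {v}) q
  obtain ⟨b, hb, hbw⟩ := exists_smul_mem_span_of_rank_le_one hrank hv w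
  refine ⟨b, hb, ?_⟩
  rw [Submodule.mkQ_apply, ← Submodule.Quotient.mk_smul, Submodule.Quotient.mk_eq_zero]
  exact hbw

/-- The same in Mathlib's currency `Module.IsTorsion`. [folklore] -/
theorem moduleIsTorsion_quotient_span_of_nonTorsion [IsDomain S]
    (hrank : ∀ v w : V, ∃ a b : S, (a ≠ 0 ∨ b ≠ 0) ∧ a • v + b • w = 0)
    {v : V} (hv : ∀ a : S, a ≠ 0 → a • v ≠ 0) :
    Module.IsTorsion S (V ⧸ Submodule.span S {v}) := by
  intro q
  obtain ⟨b, hb, hbq⟩ := isTorsion_quotient_span_of_nonTorsion hrank hv q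
  exact ⟨⟨b, mem_nonZeroDivisors_of_ne_zero hb⟩, hbq⟩

/-- **`v` torsion ⇒ `V ⧸ S∙v` is NOT torsion** as soon as `V` has a non-torsion element `w` (its class survives): «`ū_∞ = 0` in the free
part ⇒ `Q'/2` infinite, `μ(Q') ≥ 1`». [folklore] -/
theorem exists_nonTorsion_quotient_of_torsion [IsDomain S] {v w : V} {a : S} (ha : a ≠ 0) (hav : a • v = 0)
    (hw : ∀ b : S, b ≠ 0 → b • w ≠ 0) :
    ∀ b : S, b ≠ 0 → b • (Submodule.Quotient.mk w : V ⧸ Submodule.span S {v}) ≠ 0 := by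
  intro b hb h
  rw [← Submodule.Quotient.mk_smul, Submodule.Quotient.mk_eq_zero] at h
  obtain ⟨s, hs⟩ := Submodule.mem_span_singleton.mp h
  apply hw (a * b) (mul_ne_zero ha hb)
  rw [mul_smul, ← hs, smul_comm, hav, smul_zero]

/-- **`V ⧸ S∙v` torsion ⟺ `v` non-torsion** (rank `≤ 1` with a non-torsion element `w`). [folklore] -/
theorem isTorsion_quotient_span_iff [IsDomain S]
    (hrank : ∀ v w : V, ∃ a b : S, (a ≠ 0 ∨ b ≠ 0) ∧ a • v + b • w = 0)
    {w : V} (hw : ∀ b : S, b ≠ 0 → b • w ≠ 0) (v : V) :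
    (∀ q : V ⧸ Submodule.span S {v}, ∃ b : S, b ≠ 0 ∧ b • q = 0) ↔ ∀ a : S, a ≠ 0 → a • v ≠ 0 := by
  refine ⟨fun h a ha hav => ?_, fun hv => isTorsion_quotient_span_of_nonTorsion hrank hv⟩
  obtain ⟨b, hb, hbq⟩ := h (Submodule.Quotient.mk w)
  exact exists_nonTorsion_quotient_of_torsion ha hav hw b hb hbq

end RankOne

/-! ## §2 `Q'/ϖ` versus `V/⟨v̄⟩` -/

section ModTwo

variable {R : Type*} [CommRing R] {E : Type*} [AddCommGroup E] [Module R E]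

/-- `(E ⧸ R∙u) ⧸ ϖ ≃ E ⧸ (R∙u ⊔ ϖE)` («`Q'/2 = Ē/(Λu + 2Ē)`»). [folklore] -/
theorem nonempty_quotient_quotient_linearEquiv (u : E) (ϖ : R) :
    Nonempty (((E ⧸ Submodule.span R {u}) ⧸ (ϖ • (⊤ : Submodule R (E ⧸ Submodule.span R {u})))) ≃ₗ[R]
      E ⧸ (Submodule.span R {u} ⊔ ϖ • (⊤ : Submodule R E))) := by
  have hmap : (ϖ • (⊤ : Submodule R E)).map (Submodule.span R {u}).mkQ
      = ϖ • (⊤ : Submodule R (E ⧸ Submodule.span R {u})) := by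
    rw [Submodule.map_pointwise_smul, Submodule.map_top, Submodule.range_mkQ]
  exact ⟨(Submodule.quotEquivOfEq _ _ hmap.symm).trans
    (Submodule.quotientQuotientEquivQuotientSup (Submodule.span R {u}) (ϖ • ⊤))⟩

/-- `(E ⧸ ϖE) ⧸ ⟨ū⟩ ≃ E ⧸ (R∙u ⊔ ϖE)` («`V_∞/⟨ū_∞⟩ = Ē/(Λu + 2Ē)`»), so `Q'/2 ≃ V_∞/⟨ū_∞⟩`. [folklore] -/
theorem nonempty_modSMul_quotient_linearEquiv (u : E) (ϖ : R) :
    Nonempty (((E ⧸ (ϖ • (⊤ : Submodule R E))) ⧸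
        Submodule.span R {Submodule.Quotient.mk (p := ϖ • (⊤ : Submodule R E)) u}) ≃ₗ[R]
      E ⧸ (Submodule.span R {u} ⊔ ϖ • (⊤ : Submodule R E))) := by
  have hmap : (Submodule.span R {u}).map (ϖ • (⊤ : Submodule R E)).mkQ
      = Submodule.span R {Submodule.Quotient.mk (p := ϖ • (⊤ : Submodule R E)) u} := by
    rw [Submodule.map_span, Set.image_singleton, Submodule.mkQ_apply]
  refine ⟨(Submodule.quotEquivOfEq _ _ hmap.symm).trans
    ((Submodule.quotientQuotientEquivQuotientSup (ϖ • ⊤) (Submodule.span R {u})).trans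
      (Submodule.quotEquivOfEq _ _ (sup_comm _ _)))⟩

/-- `u ∈ ϖE ⇒ R∙u ⊔ ϖE = ϖE` («`u_∞ ∈ 2Ē ⟹ Q'/2 = Ē/2`», the `¬GNS(∀ m)` branch). [folklore] -/
theorem span_sup_smul_top_eq_of_mem {u : E} {ϖ : R} (hu : u ∈ ϖ • (⊤ : Submodule R E)) :
    Submodule.span R {u} ⊔ ϖ • (⊤ : Submodule R E) = ϖ • (⊤ : Submodule R E) :=
  sup_eq_right.mpr ((Submodule.span_singleton_le_iff_mem _ _).mpr hu)

/-- `u = ϖ • e ⇒ u ∈ ϖE`. [folklore] -/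
theorem mem_smul_top_of_eq_smul {u e : E} {ϖ : R} (hu : u = ϖ • e) : u ∈ ϖ • (⊤ : Submodule R E) :=
  (Submodule.mem_smul_pointwise_iff_exists u ϖ ⊤).mpr ⟨e, Submodule.mem_top, hu.symm⟩

/-- **Finite level: `u_n ∈ 2𝓔_n^χ ⇒ #(𝓔_n^χ/2) ∣ #B'_n`** (the card's `#B'_n ≥ 4^{2ⁿ}`): if `u ∈ ϖE` then `E ⧸ R∙u` surjects onto `E ⧸ ϖE`.
[folklore] -/
theorem natCard_quotient_smul_top_dvd_of_mem {u : E} {ϖ : R} (hu : u ∈ ϖ • (⊤ : Submodule R E)) :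
    Nat.card (E ⧸ (ϖ • (⊤ : Submodule R E))) ∣ Nat.card (E ⧸ Submodule.span R {u}) := by
  have hle : Submodule.span R {u} ≤ ϖ • (⊤ : Submodule R E) := (Submodule.span_singleton_le_iff_mem _ _).mpr hu
  refine AddSubgroup.card_dvd_of_surjective (Submodule.factor hle).toAddMonoidHom ?_
  exact Submodule.factor_surjective hle

end ModTwo

/-! ## §3 From one level to the limit -/

section Limit

variable {S : Type*} [CommRing S]
variable (V : ℕ → Type*) [∀ n, AddCommGroup (V n)] [∀ n, Module S (V n)]

/-- **GNS at one level makes `ū_∞` non-torsion.**  If `V_∞` projects compatibly onto the levels (`π n ū_∞ = ū_n`) and the level family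
satisfies the squares-dichotomy hypotheses over an `S` in which every non-zero element is `x^a·(unit)`, then ONE `ū_m ≠ 0` gives
`f • ū_∞ ≠ 0` for every `f ≠ 0`. [folklore] -/
theorem smul_ne_zero_of_proj_ne_zero (x : S)
    (hS : ∀ f : S, f ≠ 0 → ∃ (a : ℕ) (w : S), IsUnit w ∧ f = x ^ a * w)
    (d : ℕ → ℕ) (hd : ∀ a, ∃ n, a ≤ d n)
    (ι : ∀ n, V n →ₗ[S] V (n + 1)) (hι : ∀ n, Function.Injective (ι n))
    (N : ∀ n, V (n + 1) →ₗ[S] V n)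
    (hN : ∀ n (v : V (n + 1)), ι n (N n v) = x ^ (d n) • v)
    (u : ∀ n, V n) (hu : ∀ n, N n (u (n + 1)) = u n)
    {Vinf : Type*} [AddCommGroup Vinf] [Module S Vinf] (π : ∀ n, Vinf →ₗ[S] V n)
    (uinf : Vinf) (hπ : ∀ n, π n uinf = u n)
    {m : ℕ} (hm : u m ≠ 0) {f : S} (hf : f ≠ 0) : f • uinf ≠ 0 := by
  obtain ⟨n, hn⟩ := exists_smul_ne_zero_of_ne_zero V x hS d hd ι hι N hN u hu hm hf
  intro h
  apply hn
  rw [← hπ n, ← map_smul, h, map_zero]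

/-- The `k⟦X⟧` instance (`S = 𝔽₄⟦X⟧`): ONE `ū_m ≠ 0` ⇒ `ū_∞` is non-torsion, hence (§1) `V_∞/⟨ū_∞⟩` is torsion when `V_∞` has rank `≤ 1`.
[folklore] -/
theorem smul_ne_zero_of_proj_ne_zero_powerSeries {k : Type*} [Field k]
    (W : ℕ → Type*) [∀ n, AddCommGroup (W n)] [∀ n, Module (PowerSeries k) (W n)]
    (d : ℕ → ℕ) (hd : ∀ a, ∃ n, a ≤ d n)
    (ι : ∀ n, W n →ₗ[PowerSeries k] W (n + 1)) (hι : ∀ n, Function.Injective (ι n))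
    (N : ∀ n, W (n + 1) →ₗ[PowerSeries k] W n)
    (hN : ∀ n (v : W (n + 1)), ι n (N n v) = (PowerSeries.X : PowerSeries k) ^ (d n) • v)
    (u : ∀ n, W n) (hu : ∀ n, N n (u (n + 1)) = u n)
    {Winf : Type*} [AddCommGroup Winf] [Module (PowerSeries k) Winf] (π : ∀ n, Winf →ₗ[PowerSeries k] W n)
    (uinf : Winf) (hπ : ∀ n, π n uinf = u n)
    {m : ℕ} (hm : u m ≠ 0) {f : PowerSeries k} (hf : f ≠ 0) : f • uinf ≠ 0 :=
  smul_ne_zero_of_proj_ne_zero W PowerSeries.X powerSeries_eq_X_pow_mul_unit d hd ι hι N hN u hu π uinf hπ hm hf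

/-- Conversely, if every `ū_m = 0` (no level is a non-square) and the projections jointly detect `0`, then `ū_∞ = 0` (so `u_∞ ∈ 2Ē`,
the `μ ≥ 1` branch of §1–§2). [folklore] -/
theorem eq_zero_of_forall_proj_eq_zero {Vinf : Type*} [AddCommGroup Vinf] [Module S Vinf] (π : ∀ n, Vinf →ₗ[S] V n)
    (hsep : ∀ q : Vinf, (∀ n, π n q = 0) → q = 0) (u : ∀ n, V n) (uinf : Vinf) (hπ : ∀ n, π n uinf = u n)
    (hu : ∀ n, u n = 0) : uinf = 0 :=
  hsep uinf fun n => by rw [hπ n, hu n]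

end Limit

/-! ## §4 `V ≃ S × (torsion)` gives the rank-one hypotheses -/

section Structure

variable {S : Type*} [CommRing S] {V F : Type*} [AddCommGroup V] [Module S V] [AddCommGroup F] [Module S F]

/-- **`V ≃ S × F` with `F` torsion ⇒ rank `≤ 1`** (any two elements of `V` are linearly dependent): the hypothesis `hrank` of
`isTorsion_quotient_span_of_nonTorsion` from the card's «`V_∞ = Ē^χ/2 ≅ 𝔽₄⟦T⟧ ⊕ finite`». [folklore] -/
theorem rank_le_one_of_linearEquiv_prod [IsDomain S] (e : V ≃ₗ[S] (S × F)) (hF : ∀ f : F, ∃ c : S, c ≠ 0 ∧ c • f = 0)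
    (v w : V) : ∃ a b : S, (a ≠ 0 ∨ b ≠ 0) ∧ a • v + b • w = 0 := by
  -- kill the free coordinates with `(e w).1 • v − (e v).1 • w`, then the torsion coordinate with `c`
  obtain ⟨c, hc, hcf⟩ := hF ((e w).1 • (e v).2 - (e v).1 • (e w).2)
  by_cases hx : (e v).1 = 0
  · -- `v` itself is torsion
    obtain ⟨c', hc', hc'f⟩ := hF (e v).2
    refine ⟨c', 0, Or.inl hc', ?_⟩
    rw [zero_smul, add_zero]
    apply e.injective
    rw [map_smul, map_zero, Prod.ext_iff]
    exact ⟨by rw [Prod.smul_fst, hx, smul_zero, Prod.fst_zero], by rw [Prod.smul_snd, hc'f, Prod.snd_zero]⟩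
  · refine ⟨c * (e w).1, -(c * (e v).1), Or.inr (neg_ne_zero.mpr (mul_ne_zero hc hx)), ?_⟩
    apply e.injective
    rw [map_add, map_smul, map_smul, map_zero, Prod.ext_iff]
    refine ⟨?_, ?_⟩
    · rw [Prod.fst_add, Prod.smul_fst, Prod.smul_fst, Prod.fst_zero, smul_eq_mul, smul_eq_mul]
      ring
    · rw [Prod.snd_add, Prod.smul_snd, Prod.smul_snd, Prod.snd_zero, neg_smul, mul_smul, mul_smul, ← smul_neg,
        ← smul_add, ← sub_eq_add_neg, hcf]

/-- **`V ≃ S × F` ⇒ `e⁻¹(1, 0)` is non-torsion**: the hypothesis `hw` of `isTorsion_quotient_span_iff` /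
`isTorsion_quotient_iff_exists_proj_ne_zero`. [folklore] -/
theorem exists_nonTorsion_of_linearEquiv_prod (e : V ≃ₗ[S] (S × F)) :
    ∀ b : S, b ≠ 0 → b • e.symm (1, 0) ≠ 0 := by
  intro b hb h
  apply hb
  have h1 : e (b • e.symm (1, 0)) = 0 := by rw [h, map_zero]
  rw [map_smul, LinearEquiv.apply_symm_apply, Prod.ext_iff] at h1
  simpa using h1.1

end Structure

end Summit.BirchSwinnertonDyer.BirchSwinnertonDyer.Theorems.SignedMuAtTwo.NonsquareDescent
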